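import Literature.Topology.FourManifolds.ProjectivePlaneSuspensionRetract
import Literature.AlgebraicTopology.Homotopy.PiFourSphereThreeBound
import Literature.AlgebraicTopology.SingularHomology.SuspensionIsomorphism
import Literature.AlgebraicTopology.SingularHomology.WuVanishingOfTube
import Literature.AlgebraicTopology.Homotopy.SphereMapsHomotopyGroups
import Mathlib.Algebra.Field.ZMod
import HarnessLib

/-!
# `π₄(S³) ≅ ℤ/2` and `πₙ₊₁(Sⁿ) ≅ ℤ/2` for `n ≥ 3`

Topic `Literature/AlgebraicTopology/Homotopy`. H. Freudenthal, *Über die Klassen der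
Sphärenabbildungen I*, Compositio Math. 5 (1937), 299–314; A. Hatcher, *Algebraic Topology*
(2002), §4.2 (after Cor. 4.25: "`πₙ₊₁(Sⁿ) ≈ ℤ₂` for `n ≥ 3`, generated by the suspension of the Hopf
map"), §4.L Example 4L.2 (the Steenrod square `Sq²` detects the suspensions of the Hopf map).
This file PROVES the lower bound and assembles the computation, entirely inside the tree:

* `nullhomotopic_of_subsingleton`, **`not_forall_subsingleton_pi_four_sphere_three`** —
  `π₄(S³) ≠ 0`: with `ℤ/2`-coefficients, a generator `x ∈ H²(ℂP²)` has `Sq² x = x² ≠ 0`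
  (`steenrodSq_self`, Poincaré duality `ComplexProjectiveSpace.cupProduct_ne_zero_of_add_le`), so
  its suspension `x' ∈ H³(S ℂP²)` has `Sq² x' ≠ 0` (`suspensionIso_steenrodSqLower`); if all
  `π₄(S³, y)` were trivial, `S ℂP²` would retract onto `S ℂP¹ ≅ S³`
  (`ProjectivePlaneSuspension.exists_retraction`), `x' = r^* y` by a dimension count
  (`dim H³(S ℂP²) = dim H²(ℂP²) = 1`, `H³(S³) ≠ 0`), and `Sq² x' = r^* Sq² y ∈ r^* H⁵(S³; ℤ/2) = 0`;
* **`card_pi_four_sphere_three`** — `|π₄(S³, y)| = 2` at every base point (with the upper bound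
  `|π₄(S³)| ≤ 2`, cyclic of exponent two, of `PiFourSphereThreeBound.lean`), i.e.
  `π₄(S³) ≅ ℤ/2`;
* **`card_pi_succ_sphere`** — `|πₙ₊₁(Sⁿ, y)| = 2` for all `n ≥ 3` (Freudenthal's isomorphisms
  `Freudenthal.nonempty_mulEquiv_add`).

Everything is proved; no named facts.

## References

* H. Freudenthal, *Über die Klassen der Sphärenabbildungen I. Große Dimensionen*, Compositio
  Math. 5 (1937), 299–314. [Freudenthal1937]
* A. Hatcher, *Algebraic Topology*, CUP (2002), §4.1 p. 346, §4.2 Cor. 4.24–4.25, §4.L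
  Example 4L.2. [HatcherAT2002]
-/

noncomputable section

open Set Function Metric Topology CategoryTheory CategoryTheory.Limits
open scoped Topology
open Literature.AlgebraicTopology.SingularHomology
open Literature.Topology.FourManifolds Literature.Topology.FourManifolds.ProjectivePlaneSuspension

namespace Literature.AlgebraicTopology.Homotopy

namespace PiFourSphereThree

/-- Local notation: `𝔼 n` is `EuclideanSpace ℝ (Fin n)`. -/
local notation "𝔼 " n:arg => EuclideanSpace ℝ (Fin n)

/-- Local notation: `𝕊 n` is the unit sphere of `EuclideanSpace ℝ (Fin (n + 1))`. -/
local notation "𝕊 " n:arg => (Metric.sphere (0 : EuclideanSpace ℝ (Fin (n + 1))) 1)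

/-- `2` is prime (for the field structure of `ℤ/2`). [folklore] -/
instance factPrimeTwo : Fact (Nat.Prime 2) := ⟨Nat.prime_two⟩

/-! ### The lower bound: `π₄(S³) ≠ 0` -/

/-- **If `π₄(S³) = 0` then every map `S⁴ → S(ℂℙ¹)` is null-homotopic** (`S(ℂℙ¹) ≅ S³`, and
maps of spheres into a space with vanishing `π₄` are null-homotopic, Hatcher 2002, §4.1 p. 346).
[cite: HatcherAT2002, §4.1 (p. 346)] -/
theorem nullhomotopic_of_subsingleton (hπ : ∀ y : 𝕊 3, Subsingleton (π_ 4 (𝕊 3) y))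
    (g : C(𝕊 4, ↥subLine)) : g.Nullhomotopic := by
  let e : ↥subLine ≃ₜ 𝕊 3 := subLineSphere
  haveI : PathConnectedSpace (𝕊 3) := isPathConnected_iff_pathConnectedSpace.1
    (isPathConnected_sphere (by
      rw [← Module.finrank_eq_rank, finrank_euclideanSpace, Fintype.card_fin]; norm_num)
      (0 : 𝔼 4) zero_le_one)
  haveI : PathConnectedSpace ↥subLine := e.symm.surjective.pathConnectedSpace e.symm.continuous
  have hsub : ∀ a : ↥subLine, Subsingleton (π_ 4 ↥subLine a) := fun a => by
    haveI := hπ (e a)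
    exact (Equiv.ofBijective _ (bijective_homotopyGroupMap_homeomorph (N := Fin 4) e a)).subsingleton
  obtain ⟨a₀⟩ : Nonempty ↥subLine := inferInstance
  exact ⟨a₀, homotopic_const_of_sphere_of_subsingleton_homotopyGroup (E := 𝔼 5) (m := 4)
    (by rw [finrank_euclideanSpace, Fintype.card_fin]) (fun _ => hsub) g a₀⟩

/-- **`π₄(S³) ≠ 0`: the suspension of the Hopf map is essential** (Hatcher 2002, §4.2 after
Cor. 4.25 and §4.L, Example 4L.2 / Prop. 4L.11's method: `Sq²` is non-zero on `ℂP²` — it is the cup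
square, `x² ≠ 0` by Poincaré duality — hence non-zero on the suspension `S(ℂP²)` by the stability of
the Steenrod squares; if `π₄(S³)` vanished, `S(ℂP²) = S(ℂP¹) ∪ e⁵` would retract onto
`S(ℂP¹) ≅ S³` (`ProjectivePlaneSuspensionRetract.lean`), and `Sq² : H³ → H⁵` would factor through
`H⁵(S³; ℤ/2) = 0`). Stated as: not every `π₄(S³, y)` is trivial. [cite: HatcherAT2002, §4.L Example 4L.2, §4.2 Cor. 4.25] -/
theorem not_forall_subsingleton_pi_four_sphere_three : ¬ ∀ y : 𝕊 3, Subsingleton (π_ 4 (𝕊 3) y) := by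
  intro hπ
  let e : ↥subLine ≃ₜ 𝕊 3 := subLineSphere
  -- the retraction
  obtain ⟨r, hr⟩ := exists_retraction (nullhomotopic_of_subsingleton hπ)
  let ι : C(↥subLine, Susp (ComplexProjectiveSpace 2)) := ⟨Subtype.val, continuous_subtype_val⟩
  have hri : r.comp ι = ContinuousMap.id _ := ContinuousMap.ext hr
  -- coefficients `ℤ/2`
  let K := ZMod 2
  haveI : CharP K 2 := ZMod.charP 2
  -- a class of `H²(ℂℙ²; ℤ/2)` with non-zero square
  obtain ⟨x₀, hx₀⟩ : ∃ x₀ : singularCohomology K K (ComplexProjectiveSpace 2) (2 * 1), x₀ ≠ 0 := by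
    have h := ComplexProjectiveSpace.finrank_singularCohomology_two_mul_eq_one K 2 1 (by norm_num)
    haveI : Module.Finite K (singularCohomology K K (ComplexProjectiveSpace 2) (2 * 1)) :=
      Module.finite_of_finrank_pos (by rw [h]; norm_num)
    exact Module.finrank_pos_iff_exists_ne_zero.1 (by rw [h]; norm_num)
  have hsq : steenrodSqLower (ComplexProjectiveSpace 2) (2 * 1) (2 * 1 + 2 * 1) (2 * 1 - 2 * 1) x₀ ≠ 0 := by
    show steenrodSq (ComplexProjectiveSpace 2) (2 * 1) (2 * 1) x₀ ≠ 0
    rw [steenrodSq_self]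
    exact ComplexProjectiveSpace.cupProduct_ne_zero_of_add_le K 2 (p := 1) (q := 1) rfl (by norm_num) hx₀ hx₀
  -- suspend: `x' ∈ H³(S(ℂℙ²))` with `Sq² x' ≠ 0` in `H⁵`
  set x' := (suspensionIso K K (ComplexProjectiveSpace 2) (2 * 1)).hom x₀ with hx'
  have hsq' : steenrodSqLower (Susp (ComplexProjectiveSpace 2)) (2 * 1 + 1) (2 * 1 + 2 * 1 + 1)
      (2 * 1 - 2 * 1 + 1) x' ≠ 0 := by
    rw [hx', ← suspensionIso_steenrodSqLower (ComplexProjectiveSpace 2) (2 * 1 + 2 * 1) (2 * 1 - 2 * 1) x₀]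
    intro h0
    apply hsq
    apply (suspensionIso K K (ComplexProjectiveSpace 2) (2 * 1 + 2 * 1)).toLinearEquiv.injective
    rw [map_zero]
    exact h0
  -- `r^*` is injective with left inverse `ι^*`
  have hleft : ∀ y : singularCohomology K K ↥subLine 3,
      (singularCohomology.map K K ι 3).hom ((singularCohomology.map K K r 3).hom y) = y := fun y => by
    have h := singularCohomology.map_comp K K ι r 3
    rw [hri, singularCohomology.map_id] at h
    have h' := LinearMap.congr_fun (congrArg ModuleCat.Hom.hom h) y
    simp only [ModuleCat.hom_id, ModuleCat.hom_comp, LinearMap.id_coe, id_eq, LinearMap.coe_comp,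
      Function.comp_apply] at h'
    exact h'.symm
  have hinj : Injective (singularCohomology.map K K r 3).hom := fun a b hab => by
    have := congrArg (singularCohomology.map K K ι 3).hom hab
    rwa [hleft, hleft] at this
  -- dimensions: `dim H³(SℂP²) = dim H²(ℂP²) = 1`, `H³(A) ≠ 0`, `H⁵(A) = 0`
  have hW : Module.finrank K (singularCohomology K K (Susp (ComplexProjectiveSpace 2)) 3) = 1 := by
    rw [← (suspensionIso K K (ComplexProjectiveSpace 2) 2).toLinearEquiv.finrank_eq]
    exact ComplexProjectiveSpace.finrank_singularCohomology_two_mul_eq_one K 2 1 (by norm_num)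
  have hV : ¬ IsZero (singularCohomology K K ↥subLine 3) := fun h =>
    not_isZero_singularCohomology_sphere_top_of_field K (M := 3) (by norm_num)
      (h.of_iso (singularCohomology.mapIso K K e 3))
  have hV5 : IsZero (singularCohomology K K ↥subLine 5) :=
    (isZero_singularCohomology_sphere_of_field K (M := 3) (k := 5) (by norm_num) (by norm_num)).of_iso
      (singularCohomology.mapIso K K e 5).symm
  -- `x'` is in the range of `r^*`
  haveI : Module.Finite K (singularCohomology K K (Susp (ComplexProjectiveSpace 2)) 3) :=
    Module.finite_of_finrank_pos (by rw [hW]; norm_num)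
  haveI : Module.Finite K (singularCohomology K K ↥subLine 3) := Module.Finite.of_injective _ hinj
  haveI : Nontrivial (singularCohomology K K ↥subLine 3) := by
    by_contra h
    rw [not_nontrivial_iff_subsingleton] at h
    exact hV (ModuleCat.isZero_of_subsingleton _)
  have hrange : LinearMap.range (singularCohomology.map K K r 3).hom = ⊤ := by
    apply Submodule.eq_top_of_finrank_eq
    rw [LinearMap.finrank_range_of_inj hinj, hW]
    have h1 := LinearMap.finrank_le_finrank_of_injective hinj
    rw [hW] at h1
    have h2 : 0 < Module.finrank K (singularCohomology K K ↥subLine 3) := Module.finrank_pos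
    omega
  obtain ⟨y, hy⟩ : x' ∈ LinearMap.range (singularCohomology.map K K r 3).hom := by
    rw [hrange]; trivial
  -- `Sq² x' = r^* (Sq² y) = 0`
  haveI : Subsingleton (singularCohomology K K ↥subLine 5) := ModuleCat.subsingleton_of_isZero hV5
  have hzero : steenrodSqLower (Susp (ComplexProjectiveSpace 2)) 3 5 1 x' = 0 := by
    rw [← hy]
    show steenrodSqLower _ 3 5 1 (singularCohomology.map K K r 3 y) = 0
    rw [← steenrodSqLower_map r 5 1 y, Subsingleton.elim (steenrodSqLower ↥subLine 3 5 1 y) 0]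
    exact map_zero (singularCohomology.map K K r 5).hom
  exact hsq' hzero


/-! ### `π₄(S³) ≅ ℤ/2` -/

/-- **`|π₄(S³)| = 2` at the base point `(0, 0, 1, 0)`**: cyclic of exponent two
(`PiFourSphereThreeBound.lean`) and non-trivial. [cite: HatcherAT2002, §4.2 Cor. 4.25] -/
theorem card_pi_four_sphere_three_base :
    Nat.card (π_ 4 (𝕊 3) (Freudenthal.liftBase 2 (HopfFibration.hopf x₀))) = 2 := by
  obtain ⟨g, hg⟩ := isCyclic_pi_four_sphere_three.exists_generator
  have hcard := orderOf_eq_card_of_forall_mem_zpowers hg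
  have h2 : orderOf g ∣ 2 := orderOf_dvd_of_pow_eq_one (by rw [pow_two]; exact sq_eq_one g)
  rcases (Nat.dvd_prime Nat.prime_two).1 h2 with h1 | h2'
  · exfalso
    have hg1 : g = 1 := orderOf_eq_one_iff.1 h1
    apply not_forall_subsingleton_pi_four_sphere_three
    intro y
    have hsub : Subsingleton (π_ 4 (𝕊 3) (Freudenthal.liftBase 2 (HopfFibration.hopf x₀))) := by
      refine ⟨fun a b => ?_⟩
      obtain ⟨i, rfl⟩ := Subgroup.mem_zpowers_iff.1 (hg a)
      obtain ⟨j, rfl⟩ := Subgroup.mem_zpowers_iff.1 (hg b)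
      rw [hg1, one_zpow, one_zpow]
    obtain ⟨e⟩ := Freudenthal.nonempty_mulEquiv_of_basepoints (k := 4) (i := 3) y
      (Freudenthal.liftBase 2 (HopfFibration.hopf x₀))
    exact e.toEquiv.subsingleton
  · rw [← hcard, h2']

/-- **`π₄(S³) ≅ ℤ/2`: `|π₄(S³, y)| = 2` at every base point** (Freudenthal 1937; Hatcher 2002,
§4.2 after Cor. 4.25). [cite: HatcherAT2002, §4.2 Cor. 4.25] -/
theorem card_pi_four_sphere_three (y : 𝕊 3) : Nat.card (π_ 4 (𝕊 3) y) = 2 := by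
  obtain ⟨e⟩ := Freudenthal.nonempty_mulEquiv_of_basepoints (k := 4) (i := 3) y
    (Freudenthal.liftBase 2 (HopfFibration.hopf x₀))
  rw [Nat.card_congr e.toEquiv]
  exact card_pi_four_sphere_three_base

/-- **`πₙ₊₁(Sⁿ) ≅ ℤ/2` for all `n ≥ 3`: `|πₙ₊₁(Sⁿ, y)| = 2`** (Freudenthal's theorem: the
suspensions `π₄(S³) → π₅(S⁴) → ⋯` are isomorphisms; Hatcher 2002, Cor. 4.24–4.25).
[cite: HatcherAT2002, §4.2 Cor. 4.24 and Cor. 4.25] -/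
theorem card_pi_succ_sphere (n : ℕ) (hn : 3 ≤ n) (y : 𝕊 n) : Nat.card (π_ (n + 1) (𝕊 n) y) = 2 := by
  obtain ⟨k, rfl⟩ : ∃ k, n = 3 + k := ⟨n - 3, by omega⟩
  obtain ⟨e⟩ := Freudenthal.nonempty_mulEquiv_add (n := 3) (m := 3) (by norm_num) k
    (Freudenthal.liftBase 2 (HopfFibration.hopf x₀)) y
  have e' : π_ (3 + 1 + k) (𝕊 (3 + k)) y ≃ π_ (3 + k + 1) (𝕊 (3 + k)) y :=
    homotopyGroupCongr (finCongr (by omega))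
  rw [← Nat.card_congr (e.toEquiv.trans e')]
  exact card_pi_four_sphere_three_base

end PiFourSphereThree

end Literature.AlgebraicTopology.Homotopy

end
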